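import Literature.Topology.PlaneTopology.CrosscutProofs
import Literature.Topology.PlaneTopology.HalfPlaneEnclosure
import Mathlib.Analysis.Complex.UpperHalfPlane.Topology
import Mathlib.Analysis.SpecialFunctions.Complex.Arg
import HarnessLib

/-!
# A curve crossing a half-disc from its centre to its rim: the two sides (Newman's theorem)

Topic: Topology / plane topology. Proved consequences of Newman's cross-cut theorem
(`Literature.Topology.PlaneTopology.Newman1939_crosscut_holds`, `CrosscutProofs`; M. H. A.
Newman, *Elements of the topology of plane sets of points* (1939), Ch. V §11, Thms. 11·7–11·8)
for the open upper half-disc `D = {|z| < r} ∩ ℍ` and a simple arc `L` in `D̄` from the centre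
`0` of the diameter to a point `z₀` of the open semicircle, all of whose other points lie in
`D` — the configuration of a simple Loewner trace stopped at the exit time of the disc `r𝕌`
([LSW] Lemma 6.2: G. F. Lawler, O. Schramm, W. Werner, *Conformal restriction: the chordal
case*, J. Amer. Math. Soc. **16** (2003), Lemma 6.2, where the tip `γ(T(r))` lies on `|z| = r`
and `γ[0, T(r))` inside).

* `halfDisc r hr : JordanDomain` — the half-disc as a Jordan domain: boundary loop the
  diameter `[-r, r]` followed by the upper semicircle back to `-r` (`1`-periodic through
  `Int.fract`); the centre `0` has parameter `1/4` and `r e^{iθ₀}` has parameter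
  `(1 + θ₀/π)/2`.
* `exists_sides_of_arc` — **the two sides**: `D ∖ L = U₁ ⊔ U₂` with `U₁, U₂` open, and
  `∂U₁ ⊆ L ∪ {|z| = r} ∪ [0, ∞)`, `∂U₂ ⊆ L ∪ {|z| = r} ∪ (-∞, 0]` (the right side `U₁` is
  bounded by `L`, the real segment `[0, r]` and an arc of the circle; the left side by `L`,
  `[-r, 0]` and the complementary arc).
* `subset_right_of_near`, `subset_left_of_near` — points of `D ∖ L` near a real point of
  `(0, r) ∖ L` lie in `U₁`, near a point of `(-r, 0) ∖ L` in `U₂`;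
* `inter_subset_right_of_isPreconnected` — a connected subset of `{|z| < r, im ≥ 0}` missing
  `L` and the non-positive reals, and containing a real point, has its `ℍ`-part inside `U₁`
  (used for the hull `A ∪ [a₀, a₁]` of [LSW] Lemma 6.2).

## References

* M. H. A. Newman, *Elements of the topology of plane sets of points*, CUP (1939), Ch. V §11.
* G. F. Lawler, O. Schramm, W. Werner, *Conformal restriction: the chordal case*, J. Amer. Math.
  Soc. **16** (2003), Lemma 6.2. [LawlerSchrammWerner2003Restriction]
-/

noncomputable section

namespace Literature.Topology.PlaneTopology

open Set _root_.Topology Metric Filter Function Complex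
open UpperHalfPlane (upperHalfPlaneSet isOpen_upperHalfPlaneSet)
open Literature.Probability.RandomPlanarGeometry (JordanDomain)
open scoped unitInterval Real

/-! ### The half-disc and its frontier -/

section Frontier

variable {r : ℝ}

/-- The closure of the open upper half-disc is the closed upper half-disc. [folklore] -/
theorem closure_ball_inter_upperHalfPlaneSet (hr : 0 < r) :
    closure (ball (0 : ℂ) r ∩ upperHalfPlaneSet) = closedBall 0 r ∩ {z : ℂ | 0 ≤ z.im} := by
  apply Subset.antisymm
  · refine (closure_inter_subset_inter_closure _ _).trans ?_
    rw [closure_ball _ hr.ne', show closure upperHalfPlaneSet = {z : ℂ | 0 ≤ z.im} from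
      closure_setOf_lt_im 0]
  · rintro z ⟨hz, hzim⟩
    rw [mem_closedBall, dist_zero_right] at hz
    rw [mem_setOf_eq] at hzim
    -- `w δ = (1 - 2δ) z + i δ r → z`, inside for small `δ > 0`
    have hlim : Tendsto (fun δ : ℝ ↦ ((1 - 2 * δ : ℝ) : ℂ) * z + Complex.I * ((δ * r : ℝ) : ℂ))
        (𝓝[>] 0) (𝓝 z) := by
      have : Continuous fun δ : ℝ ↦ ((1 - 2 * δ : ℝ) : ℂ) * z + Complex.I * ((δ * r : ℝ) : ℂ) := by
        fun_prop
      simpa using (this.tendsto 0).mono_left nhdsWithin_le_nhds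
    refine mem_closure_of_tendsto hlim ?_
    have hev : ∀ᶠ δ : ℝ in 𝓝[>] 0, δ < 1 / 2 :=
      (eventually_lt_nhds (by norm_num : (0 : ℝ) < 1 / 2)).filter_mono nhdsWithin_le_nhds
    filter_upwards [hev, self_mem_nhdsWithin] with δ hδ hδ0
    have hδ0' : 0 < δ := hδ0
    constructor
    · rw [mem_ball, dist_zero_right]
      calc ‖((1 - 2 * δ : ℝ) : ℂ) * z + Complex.I * ((δ * r : ℝ) : ℂ)‖
          ≤ ‖((1 - 2 * δ : ℝ) : ℂ) * z‖ + ‖Complex.I * ((δ * r : ℝ) : ℂ)‖ := norm_add_le _ _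
        _ = (1 - 2 * δ) * ‖z‖ + δ * r := by
            rw [norm_mul, norm_mul, norm_I, one_mul, Complex.norm_real, Complex.norm_real,
              Real.norm_eq_abs, Real.norm_eq_abs, abs_of_pos (by linarith),
              abs_of_pos (by positivity)]
        _ ≤ (1 - 2 * δ) * r + δ * r := by gcongr; linarith
        _ < r := by nlinarith
    · show 0 < (((1 - 2 * δ : ℝ) : ℂ) * z + Complex.I * ((δ * r : ℝ) : ℂ)).im
      have : (((1 - 2 * δ : ℝ) : ℂ) * z + Complex.I * ((δ * r : ℝ) : ℂ)).im = (1 - 2 * δ) * z.im + δ * r := by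
        simp [mul_comm]
      rw [this]
      have h1 : 0 ≤ (1 - 2 * δ) * z.im := mul_nonneg (by linarith) hzim
      have h2 : 0 < δ * r := mul_pos hδ0' hr
      linarith

/-- The frontier of the open upper half-disc: the diameter together with the upper
semicircle. [folklore] -/
theorem frontier_ball_inter_upperHalfPlaneSet (hr : 0 < r) :
    frontier (ball (0 : ℂ) r ∩ upperHalfPlaneSet) =
      {z : ℂ | z.im = 0 ∧ |z.re| ≤ r} ∪ {z : ℂ | ‖z‖ = r ∧ 0 ≤ z.im} := by
  rw [frontier, closure_ball_inter_upperHalfPlaneSet hr,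
    (isOpen_ball.inter isOpen_upperHalfPlaneSet).interior_eq]
  ext z
  rw [Set.mem_sdiff, mem_inter_iff, mem_closedBall, dist_zero_right, mem_inter_iff, mem_ball,
    dist_zero_right, mem_setOf_eq, mem_union, mem_setOf_eq, mem_setOf_eq]
  change (‖z‖ ≤ r ∧ 0 ≤ z.im) ∧ ¬(‖z‖ < r ∧ 0 < z.im) ↔ z.im = 0 ∧ |z.re| ≤ r ∨ ‖z‖ = r ∧ 0 ≤ z.im
  constructor
  · rintro ⟨⟨hzr, hzim⟩, h⟩
    rcases hzr.lt_or_eq with hlt | heq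
    · have him : ¬ 0 < z.im := fun h' ↦ h ⟨hlt, h'⟩
      have him0 : z.im = 0 := le_antisymm (not_lt.1 him) hzim
      exact Or.inl ⟨him0, (abs_re_le_norm z).trans hzr⟩
    · exact Or.inr ⟨heq, hzim⟩
  · rintro (⟨him, hre⟩ | ⟨hn, him⟩)
    · have hz : ‖z‖ = |z.re| := by
        rw [← Complex.re_add_im z, him]
        simp
      exact ⟨⟨by rw [hz]; exact hre, him.ge⟩, fun h ↦ absurd him h.2.ne'⟩
    · exact ⟨⟨hn.le, him⟩, fun h ↦ absurd hn h.1.ne⟩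

end Frontier

/-! ### The boundary loop: diameter then upper semicircle -/

section Loop

variable {r : ℝ}

/-- `circleMap 0 r π = -r`. [folklore] -/
theorem circleMap_zero_pi (r : ℝ) : circleMap 0 r π = -(r : ℂ) := by
  simp [circleMap, exp_pi_mul_I]

/-- The upper semicircle of radius `r`, as a path from `r` to `-r`. [folklore] -/
def upperArc (r : ℝ) : Path (r : ℂ) (-(r : ℂ)) :=
  ((Path.segment (0 : ℝ) π).map (continuous_circleMap' 0 r)).cast (circleMap_zero_zero r).symm
    (circleMap_zero_pi r).symm

/-- Points of the upper semicircle path. [folklore] -/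
theorem upperArc_apply (r : ℝ) (s : I) : upperArc r s = circleMap 0 r (π * s) := by
  change circleMap 0 r (Path.segment (0 : ℝ) π s) = _
  rw [Path.segment_apply, AffineMap.lineMap_apply_ring']
  ring_nf

/-- The range of the upper semicircle path is the closed upper semicircle. [folklore] -/
theorem range_upperArc (hr : 0 < r) : range (upperArc r) = {z : ℂ | ‖z‖ = r ∧ 0 ≤ z.im} := by
  have h : range (upperArc r) = circleMap 0 r '' uIcc 0 π := by
    rw [upperArc, Path.cast_coe, range_segment_map_circleMap]
  rw [h, uIcc_of_le Real.pi_pos.le]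
  apply Subset.antisymm
  · rintro _ ⟨θ, hθ, rfl⟩
    refine ⟨by rw [norm_circleMap_zero, abs_of_pos hr], ?_⟩
    show 0 ≤ (circleMap 0 r θ).im
    simp only [circleMap, zero_add, mul_im, ofReal_re, exp_ofReal_mul_I_im, ofReal_im,
      exp_ofReal_mul_I_re, zero_mul, add_zero]
    exact mul_nonneg hr.le (Real.sin_nonneg_of_mem_Icc hθ)
  · rintro z ⟨hzn, hzim⟩
    refine ⟨arg z, ⟨arg_nonneg_iff.2 hzim, arg_le_pi z⟩, ?_⟩
    rw [← hzn]
    exact circleMap_norm_arg z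

/-- The boundary loop of the half-disc: the diameter from `-r` to `r`, then the upper
semicircle back to `-r`. [folklore] -/
def hdLoop (r : ℝ) : Path (-(r : ℂ)) (-(r : ℂ)) :=
  (Path.segment (-(r : ℂ)) r).trans (upperArc r)

/-- The range of the diameter path is the diameter `{im = 0, |re| ≤ r}`. [folklore] -/
theorem range_segment_diameter (hr : 0 < r) :
    range (Path.segment (-(r : ℂ)) r) = {z : ℂ | z.im = 0 ∧ |z.re| ≤ r} := by
  rw [Path.range_segment]
  apply Subset.antisymm
  · rintro z ⟨a, b, ha, hb, hab, rfl⟩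
    have him : (a • (-(r : ℂ)) + b • (r : ℂ)).im = 0 := by simp
    have hre : (a • (-(r : ℂ)) + b • (r : ℂ)).re = r * (b - a) := by simp; ring
    refine ⟨him, ?_⟩
    rw [hre, abs_le]
    constructor <;> nlinarith
  · rintro z ⟨him, hre⟩
    rw [abs_le] at hre
    refine ⟨(r - z.re) / (2 * r), (r + z.re) / (2 * r), div_nonneg (by linarith) (by positivity),
      div_nonneg (by linarith) (by positivity), by field_simp; ring, ?_⟩
    apply Complex.ext
    · simp only [add_re, smul_re, neg_re, ofReal_re, smul_eq_mul]
      field_simp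
      ring
    · simp only [add_im, smul_im, neg_im, ofReal_im, neg_zero, smul_eq_mul, mul_zero, add_zero]
      exact him.symm

/-- The range of the boundary loop is the frontier of the half-disc. [folklore] -/
theorem range_hdLoop (hr : 0 < r) :
    range (hdLoop r) = frontier (ball (0 : ℂ) r ∩ upperHalfPlaneSet) := by
  rw [hdLoop, Path.trans_range, range_segment_diameter hr, range_upperArc hr,
    frontier_ball_inter_upperHalfPlaneSet hr]

/-- The upper semicircle path is injective (`r > 0`). [folklore] -/
theorem injective_upperArc (hr : 0 < r) : Injective (upperArc r) :=
  injective_path_cast (injective_segment_map_circleMap hr.ne' ⟨le_rfl, Real.pi_pos.le⟩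
    ⟨Real.pi_pos.le, le_rfl⟩ Real.pi_pos.ne) _ _

/-- The diameter and the upper semicircle meet only at `±r`. [folklore] -/
theorem eq_or_eq_of_mem_inter (hr : 0 < r) {w : ℂ}
    (hw : w ∈ range (Path.segment (-(r : ℂ)) r) ∩ range (upperArc r)) :
    w = -(r : ℂ) ∨ w = r := by
  rw [range_segment_diameter hr, range_upperArc hr] at hw
  obtain ⟨⟨him, -⟩, hn, -⟩ := hw
  have hw' : w = (w.re : ℂ) := by
    rw [← Complex.re_add_im w, him]
    simp
  have hre : |w.re| = r := by
    rw [hw'] at hn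
    rwa [Complex.norm_real, Real.norm_eq_abs] at hn
  rcases (abs_eq hr.le).1 hre with h | h
  · right
    rw [hw', h]
  · left
    rw [hw', h, ofReal_neg]

/-- The boundary loop is injective on one period. [folklore] -/
theorem injOn_hdLoop_extend (hr : 0 < r) : InjOn (hdLoop r).extend (Ico 0 1) :=
  injOn_path_extend_trans_Ico' (Path.segment_injective_of_ne (by
      intro h
      have := congrArg Complex.re h
      simp at this
      linarith))
    (injective_upperArc hr) fun _ hw ↦ eq_or_eq_of_mem_inter hr hw

end Loop

/-! ### The half-disc as a Jordan domain -/

section HalfDisc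

variable {r : ℝ}

/-- **The open upper half-disc `{|z| < r} ∩ ℍ` as a Jordan domain**, with boundary loop the
diameter from `-r` to `r` followed by the upper semicircle back to `-r`, made `1`-periodic.
[folklore] -/
def halfDisc (r : ℝ) (hr : 0 < r) : JordanDomain where
  carrier := ball 0 r ∩ upperHalfPlaneSet
  boundary s := (hdLoop r).extend (Int.fract s)
  isOpen := isOpen_ball.inter isOpen_upperHalfPlaneSet
  isBounded := isBounded_ball.subset inter_subset_left
  isConnected := by
    refine ((convex_ball (0 : ℂ) r).inter (convex_halfSpace_im_gt 0)).isConnected ?_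
    refine ⟨(r / 2 : ℝ) * Complex.I, ?_, ?_⟩
    · rw [mem_ball, dist_zero_right, norm_mul, Complex.norm_real, norm_I, mul_one, Real.norm_eq_abs,
        abs_of_pos (by positivity)]
      linarith
    · show 0 < (((r / 2 : ℝ) : ℂ) * Complex.I).im
      simp [hr]
  continuous_boundary := path_continuous_extend_fract _
  periodic_boundary := path_periodic_extend_fract _
  injOn_boundary := by
    intro s hs t ht hst
    simp only [Int.fract_eq_self.2 hs, Int.fract_eq_self.2 ht] at hst
    exact injOn_hdLoop_extend hr hs ht hst
  range_boundary := by rw [path_range_extend_fract, range_hdLoop hr]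

/-- The carrier of the half-disc. [folklore] -/
@[simp] theorem carrier_halfDisc (hr : 0 < r) :
    (halfDisc r hr).carrier = ball 0 r ∩ upperHalfPlaneSet := rfl

/-- The boundary loop of the half-disc on `[0, 1)`. [folklore] -/
theorem halfDisc_boundary_of_mem (hr : 0 < r) {s : ℝ} (hs : s ∈ Ico (0 : ℝ) 1) :
    (halfDisc r hr).boundary s = hdLoop r ⟨s, hs.1, hs.2.le⟩ := by
  change (hdLoop r).extend (Int.fract s) = _
  rw [Int.fract_eq_self.2 hs, Path.extend_apply _ ⟨hs.1, hs.2.le⟩]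

/-- On `[0, 1/2]` the boundary loop runs along the diameter: `boundary s = r (4s - 1)`.
[folklore] -/
theorem halfDisc_boundary_of_le_half (hr : 0 < r) {s : ℝ} (hs0 : 0 ≤ s) (hs : s ≤ 1 / 2) :
    (halfDisc r hr).boundary s = ((r * (4 * s - 1) : ℝ) : ℂ) := by
  rw [halfDisc_boundary_of_mem hr ⟨hs0, by linarith⟩, hdLoop, Path.trans_apply]
  rw [dif_pos (show ((⟨s, hs0, by linarith⟩ : I) : ℝ) ≤ 1 / 2 from hs), Path.segment_apply,
    AffineMap.lineMap_apply_module]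
  simp only [Complex.real_smul]
  push_cast
  ring

/-- On `(1/2, 1)` the boundary loop runs along the semicircle:
`boundary s = r e^{iπ(2s - 1)}`. [folklore] -/
theorem halfDisc_boundary_of_half_lt (hr : 0 < r) {s : ℝ} (hs : 1 / 2 < s) (hs1 : s < 1) :
    (halfDisc r hr).boundary s = circleMap 0 r (π * (2 * s - 1)) := by
  rw [halfDisc_boundary_of_mem hr ⟨by linarith, hs1⟩, hdLoop, Path.trans_apply,
    dif_neg (show ¬ ((⟨s, by linarith, hs1.le⟩ : I) : ℝ) ≤ 1 / 2 from not_le.2 hs), upperArc_apply]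

/-- The centre `0` of the diameter has parameter `1/4`. [folklore] -/
theorem halfDisc_boundary_quarter (hr : 0 < r) : (halfDisc r hr).boundary (1 / 4) = 0 := by
  rw [halfDisc_boundary_of_le_half hr (by norm_num) (by norm_num)]
  norm_num

/-- The parameter of a point `z₀` of the open upper semicircle: `(1 + arg z₀ / π) / 2`.
[folklore] -/
def arcParam (z₀ : ℂ) : ℝ := (1 + arg z₀ / π) / 2

variable {z₀ : ℂ}

/-- For `im z₀ > 0`, `0 < arg z₀ < π`. [folklore] -/
theorem arg_mem_Ioo_of_im_pos (hz₀ : 0 < z₀.im) : arg z₀ ∈ Ioo 0 π := by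
  refine ⟨lt_of_le_of_ne (arg_nonneg_iff.2 hz₀.le) fun h ↦ ?_, lt_of_le_of_ne (arg_le_pi z₀) fun h ↦ ?_⟩
  · exact hz₀.ne' (arg_eq_zero_iff.1 h.symm).2
  · exact hz₀.ne' (arg_eq_pi_iff.1 h).2

/-- The parameter of a point of the open semicircle lies in `(1/2, 1)`. [folklore] -/
theorem arcParam_mem (hz₀ : 0 < z₀.im) : arcParam z₀ ∈ Ioo (1 / 2 : ℝ) 1 := by
  have h := arg_mem_Ioo_of_im_pos hz₀
  have h1 : 0 < arg z₀ / π := div_pos h.1 Real.pi_pos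
  have h2 : arg z₀ / π < 1 := (div_lt_one Real.pi_pos).2 h.2
  constructor <;> simp only [arcParam] <;> linarith

/-- The boundary loop at `arcParam z₀` is `z₀` (`|z₀| = r`, `im z₀ > 0`). [folklore] -/
theorem halfDisc_boundary_arcParam (hr : 0 < r) (hz₀n : ‖z₀‖ = r) (hz₀ : 0 < z₀.im) :
    (halfDisc r hr).boundary (arcParam z₀) = z₀ := by
  have h := arcParam_mem hz₀
  rw [halfDisc_boundary_of_half_lt hr h.1 h.2]
  have : π * (2 * arcParam z₀ - 1) = arg z₀ := by
    simp only [arcParam]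
    field_simp
    ring
  rw [this, ← hz₀n]
  exact circleMap_norm_arg z₀

/-- Points of the right boundary arc (parameters in `[1/4, arcParam z₀]`) lie on the circle
`|z| = r` or on the non-negative real axis. [folklore] -/
theorem norm_eq_or_of_mem_right (hr : 0 < r) (hz₀ : 0 < z₀.im) {z : ℂ}
    (hz : z ∈ (halfDisc r hr).boundary '' Icc (1 / 4) (arcParam z₀)) :
    ‖z‖ = r ∨ (z.im = 0 ∧ 0 ≤ z.re) := by
  obtain ⟨s, hs, rfl⟩ := hz
  have h := arcParam_mem hz₀
  by_cases hsh : s ≤ 1 / 2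
  · right
    rw [halfDisc_boundary_of_le_half hr (by linarith [hs.1]) hsh, ofReal_im, ofReal_re]
    exact ⟨rfl, mul_nonneg hr.le (by linarith [hs.1])⟩
  · left
    rw [halfDisc_boundary_of_half_lt hr (not_le.1 hsh) (hs.2.trans_lt h.2), norm_circleMap_zero,
      abs_of_pos hr]

/-- Points of the left boundary arc (parameters in `[arcParam z₀, 1/4 + 1]`) lie on the circle
`|z| = r` or on the non-positive real axis. [folklore] -/
theorem norm_eq_or_of_mem_left (hr : 0 < r) (hz₀ : 0 < z₀.im) {z : ℂ}
    (hz : z ∈ (halfDisc r hr).boundary '' Icc (arcParam z₀) (1 / 4 + 1)) :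
    ‖z‖ = r ∨ (z.im = 0 ∧ z.re ≤ 0) := by
  obtain ⟨s, hs, rfl⟩ := hz
  have h := arcParam_mem hz₀
  by_cases hs1 : s < 1
  · left
    rw [halfDisc_boundary_of_half_lt hr (by linarith [hs.1, h.1]) hs1, norm_circleMap_zero,
      abs_of_pos hr]
  · right
    rw [not_lt] at hs1
    have hper : (halfDisc r hr).boundary s = (halfDisc r hr).boundary (s - 1) := by
      have := (halfDisc r hr).periodic_boundary (s - 1)
      rw [sub_add_cancel] at this
      exact this
    rw [hper, halfDisc_boundary_of_le_half hr (by linarith) (by linarith [hs.2]), ofReal_im,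
      ofReal_re]
    exact ⟨rfl, mul_nonpos_of_nonneg_of_nonpos hr.le (by linarith [hs.2])⟩

/-! ### A simple arc from the centre to the rim is a cross-cut; its two sides -/

variable {η : ℝ → ℂ}

/-- A simple arc from `0` to a point `z₀` of the open semicircle whose interior lies in the
open half-disc is a cross-cut of the half-disc. [folklore] -/
theorem isCrosscut_halfDisc (hr : 0 < r) (hηc : ContinuousOn η (Icc 0 1)) (hηi : InjOn η (Icc 0 1))
    (hη0 : η 0 = 0) (hη1 : η 1 = z₀) (hz₀n : ‖z₀‖ = r) (hz₀ : 0 < z₀.im)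
    (hin : ∀ x ∈ Ioo (0 : ℝ) 1, ‖η x‖ < r ∧ 0 < (η x).im) :
    (halfDisc r hr).IsCrosscut (η '' Icc 0 1) ((halfDisc r hr).boundary (1 / 4))
      ((halfDisc r hr).boundary (arcParam z₀)) := by
  rw [halfDisc_boundary_quarter hr, halfDisc_boundary_arcParam hr hz₀n hz₀]
  refine ⟨⟨η, hηc, hηi, rfl, hη0, hη1⟩, ?_, ?_, ?_, ?_⟩
  · rw [← halfDisc_boundary_quarter hr]
    exact (halfDisc r hr).boundary_mem_frontier _
  · rw [← halfDisc_boundary_arcParam hr hz₀n hz₀]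
    exact (halfDisc r hr).boundary_mem_frontier _
  · intro h
    rw [← h] at hz₀
    simp at hz₀
  · rintro _ ⟨⟨x, hx, rfl⟩, hne⟩
    simp only [mem_insert_iff, mem_singleton_iff, not_or] at hne
    have hx0 : x ≠ 0 := fun h ↦ hne.1 (by rw [h, hη0])
    have hx1 : x ≠ 1 := fun h ↦ hne.2 (by rw [h, hη1])
    have hx' : x ∈ Ioo (0 : ℝ) 1 := ⟨lt_of_le_of_ne hx.1 (Ne.symm hx0), lt_of_le_of_ne hx.2 hx1⟩
    exact ⟨by rw [mem_ball, dist_zero_right]; exact (hin x hx').1, (hin x hx').2⟩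

/-- **The two sides of an arc from the centre to the rim of a half-disc** (Newman's cross-cut
theorem for the half-disc): if `η` is a simple arc from `0` to `z₀` (`|z₀| = r`, `im z₀ > 0`)
with `η(0, 1)` inside the open upper half-disc `D` of radius `r`, then `D ∖ η[0, 1]` is the
disjoint union of two open sets `U₁` (the right side) and `U₂` (the left side) with
`∂U₁ ⊆ η[0,1] ∪ {|z| = r} ∪ {im = 0, re ≥ 0}` and `∂U₂ ⊆ η[0,1] ∪ {|z| = r} ∪ {im = 0, re ≤ 0}`.
[cite: Newman1939, Ch. V §11, Thms. 11·7 and 11·8] -/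
theorem exists_sides_of_arc (hr : 0 < r) (hηc : ContinuousOn η (Icc 0 1)) (hηi : InjOn η (Icc 0 1))
    (hη0 : η 0 = 0) (hη1 : η 1 = z₀) (hz₀n : ‖z₀‖ = r) (hz₀ : 0 < z₀.im)
    (hin : ∀ x ∈ Ioo (0 : ℝ) 1, ‖η x‖ < r ∧ 0 < (η x).im) :
    ∃ U₁ U₂ : Set ℂ, IsOpen U₁ ∧ IsOpen U₂ ∧ Disjoint U₁ U₂ ∧
      U₁ ∪ U₂ = (ball 0 r ∩ upperHalfPlaneSet) \ η '' Icc 0 1 ∧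
      frontier U₁ ⊆ η '' Icc 0 1 ∪ {z : ℂ | ‖z‖ = r ∨ (z.im = 0 ∧ 0 ≤ z.re)} ∧
      frontier U₂ ⊆ η '' Icc 0 1 ∪ {z : ℂ | ‖z‖ = r ∨ (z.im = 0 ∧ z.re ≤ 0)} := by
  have h := arcParam_mem hz₀
  obtain ⟨U₁, U₂, hU₁o, hU₂o, -, -, hdisj, hunion, hf₁, hf₂⟩ :=
    Newman1939_crosscut_holds (halfDisc r hr) (η '' Icc 0 1) (1 / 4) (arcParam z₀)
      (by linarith [h.1]) (by linarith [h.2]) (isCrosscut_halfDisc hr hηc hηi hη0 hη1 hz₀n hz₀ hin)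
  refine ⟨U₁, U₂, hU₁o, hU₂o, hdisj, hunion, ?_, ?_⟩
  · rw [hf₁]
    exact union_subset_union_right _ fun z hz ↦ norm_eq_or_of_mem_right hr hz₀ hz
  · rw [hf₂]
    exact union_subset_union_right _ fun z hz ↦ norm_eq_or_of_mem_left hr hz₀ hz

/-! ### Consequences: which side is near the real axis, and the side of a hull -/

variable {L U₁ U₂ : Set ℂ}

/-- Points of `D ∖ L` near a real point `q ∈ (0, r)` off `L` lie in the right side `U₁`
(`q` is not in the closure of `U₂`). [folklore] -/
theorem subset_right_of_near (hunion : U₁ ∪ U₂ = (ball 0 r ∩ upperHalfPlaneSet) \ L)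
    (hf₂ : frontier U₂ ⊆ L ∪ {z : ℂ | ‖z‖ = r ∨ (z.im = 0 ∧ z.re ≤ 0)}) {q : ℝ} (hq0 : 0 < q)
    (hqr : q < r) (hqL : (q : ℂ) ∉ L) :
    ∃ δ > 0, ball (q : ℂ) δ ∩ ((ball 0 r ∩ upperHalfPlaneSet) \ L) ⊆ U₁ := by
  have hq : (q : ℂ) ∉ closure U₂ := by
    rw [closure_eq_self_union_frontier]
    rintro (hq | hq)
    · have : (q : ℂ) ∈ (ball 0 r ∩ upperHalfPlaneSet) \ L := hunion ▸ Or.inr hq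
      have him : 0 < (q : ℂ).im := this.1.2
      simp at him
    · rcases hf₂ hq with hq | hq | ⟨-, hq⟩
      · exact hqL hq
      · rw [Complex.norm_real, Real.norm_eq_abs, abs_of_pos hq0] at hq
        exact hqr.ne hq
      · rw [ofReal_re] at hq
        linarith
  have hopen : IsOpen (closure U₂)ᶜ := isClosed_closure.isOpen_compl
  obtain ⟨δ, hδ, hball⟩ := Metric.isOpen_iff.1 hopen _ hq
  refine ⟨δ, hδ, fun z hz ↦ ?_⟩
  have hz' : z ∈ U₁ ∪ U₂ := hunion ▸ hz.2
  rcases hz' with h | h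
  · exact h
  · exact absurd (subset_closure h) (hball hz.1)

/-- Points of `D ∖ L` near a real point `q ∈ (-r, 0)` off `L` lie in the left side `U₂`.
[folklore] -/
theorem subset_left_of_near (hunion : U₁ ∪ U₂ = (ball 0 r ∩ upperHalfPlaneSet) \ L)
    (hf₁ : frontier U₁ ⊆ L ∪ {z : ℂ | ‖z‖ = r ∨ (z.im = 0 ∧ 0 ≤ z.re)}) {q : ℝ} (hq0 : q < 0)
    (hqr : -r < q) (hqL : (q : ℂ) ∉ L) :
    ∃ δ > 0, ball (q : ℂ) δ ∩ ((ball 0 r ∩ upperHalfPlaneSet) \ L) ⊆ U₂ := by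
  have hq : (q : ℂ) ∉ closure U₁ := by
    rw [closure_eq_self_union_frontier]
    rintro (hq | hq)
    · have : (q : ℂ) ∈ (ball 0 r ∩ upperHalfPlaneSet) \ L := hunion ▸ Or.inl hq
      have him : 0 < (q : ℂ).im := this.1.2
      simp at him
    · rcases hf₁ hq with hq | hq | ⟨-, hq⟩
      · exact hqL hq
      · rw [Complex.norm_real, Real.norm_eq_abs, abs_of_neg hq0] at hq
        linarith
      · rw [ofReal_re] at hq
        linarith
  have hopen : IsOpen (closure U₁)ᶜ := isClosed_closure.isOpen_compl
  obtain ⟨δ, hδ, hball⟩ := Metric.isOpen_iff.1 hopen _ hq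
  refine ⟨δ, hδ, fun z hz ↦ ?_⟩
  have hz' : z ∈ U₁ ∪ U₂ := hunion ▸ hz.2
  rcases hz' with h | h
  · exact absurd (subset_closure h) (hball hz.1)
  · exact h

/-- **The side of a hull.** A preconnected subset `P` of `{|z| < r, im ≥ 0}` which misses `L`,
whose real points are positive and which contains a real point, has its part in `ℍ` inside the
right side `U₁` (its part in `U₂` is relatively clopen and misses the real point). In [LSW]
Lemma 6.2 this is applied to `P = A ∪ [a₀, a₁]` for the hull `A`. [folklore] -/
theorem inter_subset_right_of_isPreconnected (hU₂o : IsOpen U₂)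
    (hunion : U₁ ∪ U₂ = (ball 0 r ∩ upperHalfPlaneSet) \ L)
    (hf₂ : frontier U₂ ⊆ L ∪ {z : ℂ | ‖z‖ = r ∨ (z.im = 0 ∧ z.re ≤ 0)}) {P : Set ℂ}
    (hP : IsPreconnected P) (hPsub : P ⊆ ball 0 r ∩ {z : ℂ | 0 ≤ z.im}) (hPL : Disjoint P L)
    (hPreal : ∀ z ∈ P, z.im = 0 → 0 < z.re) (hPq : ∃ z ∈ P, z.im = 0) :
    P ∩ upperHalfPlaneSet ⊆ U₁ := by
  -- `P ∩ closure U₂ ⊆ U₂`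
  have hcl : ∀ z ∈ P, z ∈ closure U₂ → z ∈ U₂ := by
    intro z hzP hz
    rw [closure_eq_self_union_frontier] at hz
    rcases hz with hz | hz
    · exact hz
    · rcases hf₂ hz with hz | hz | ⟨him, hre⟩
      · exact absurd hz (Set.disjoint_left.1 hPL hzP)
      · have := (hPsub hzP).1
        rw [mem_ball, dist_zero_right, hz] at this
        exact absurd this (lt_irrefl _)
      · linarith [hPreal z hzP him]
  -- `P ⊆ U₂` or `P ⊆ (closure U₂)ᶜ`
  have hcases := (isPreconnected_iff_subset_of_disjoint.1 hP) U₂ (closure U₂)ᶜ hU₂o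
    isClosed_closure.isOpen_compl (fun z hz ↦ ?_) ?_
  · rcases hcases with hsub | hsub
    · obtain ⟨z, hzP, him⟩ := hPq
      have : z ∈ (ball 0 r ∩ upperHalfPlaneSet) \ L := hunion ▸ Or.inr (hsub hzP)
      have him' : 0 < z.im := this.1.2
      linarith
    · rintro z ⟨hzP, hzH⟩
      have hz : z ∈ U₁ ∪ U₂ := by
        rw [hunion]
        exact ⟨⟨(hPsub hzP).1, hzH⟩, Set.disjoint_left.1 hPL hzP⟩
      rcases hz with hz | hz
      · exact hz
      · exact absurd (subset_closure hz) (hsub hzP)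
  · by_cases h : z ∈ closure U₂
    · exact Or.inl (hcl z hz h)
    · exact Or.inr h
  · rw [Set.eq_empty_iff_forall_notMem]
    rintro z ⟨-, hz1, hz2⟩
    exact hz2 (subset_closure hz1)

end HalfDisc

end Literature.Topology.PlaneTopology

end
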